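import Literature.MathematicalPhysics.QuantumFieldTheory.Balaban1983to89.B15Prop1LocalChartFromThm1AtBaseCentral
import Literature.MathematicalPhysics.QuantumFieldTheory.Balaban1983to89.B15Prop1LocalChartAtBaseFieldTower
import Literature.MathematicalPhysics.QuantumFieldTheory.Balaban1983to89.B15Prop1SliceNondegeneracyFromRealCoerciveTower

/-!
# `Balaban1983to89.B15Prop1LocalChartFromThm1AtBaseCentralTower` — [Balaban1985Variational] = «[15]», Thm 1 p. 279, (2),(4) p. 278, Prop. 8 p. 305, Prop. 9 p. 309; [Balaban1988Convergent]
# = «[III]», (2.10)–(2.12) p. 256: THE LOCAL-CLASS, TOWER-CENTRAL CHART THEOREM UNDER THE PER-TOWER (0.4) GUARDS — the «TP» twin of `B15Prop1LocalChartFromThm1AtBaseCentral`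
# (LOCATED-E1-HSB repair step (r3), link 8∕9)

Honest framing: statement-level skeleton of published theorems with citation tags; proofs where landed; nothing here is a claim about the
Yang–Mills mass gap.  Cell `pub-ymgap`, HUMAN RULING D-0062 (Track A), seat `pub-ymgap-dag-n12-c` g24 (lane owner N12 = [B15], strategy s1; lane memo `N12-UNIFORMITY-SPEC.md` §6,
plan g91 word pub-ymgap INBOX l.45435 «(r3) = ADDITIVE TP-twins»); count-neutral; N12 NOT discharged; finite 𝕋⁴ at fixed ε; nothing continuum ∕ OS ∕ mass-gap ∕ Clay.

WHAT CHANGES AGAINST THE TWIN (dag-n12-w1 g3's `B15Prop1LocalChartFromThm1AtBaseCentral`, untouched).  `hsbQ`∕`hsbU : SmallBelow k ·` ↦ the ENUMERATED per-tower guards `hgQ`∕`hgU` at the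
constrained bonds of `𝔹`; the guards of the NEARBY chart configurations are the per-tower ones (`eventually_guardOn_constr`), the identification `iterMh = ↑Ū` at a guarded chart point is
`iterMh_coeField_apply_eq_of_guardOn_towerRegion`, the datum vector's continuity at the base datum is §1's `continuousAt_datum_of_guardOn` (analyticity of the iterate at each constrained
bond on its tower), the chart theorem is `exists_localChart_at_baseField_of_guardOn`, (β)'s regularity `analyticAt_sliceDatum_of_guardOn`; `datum_gaugeAct_of_central`, `agreeOn_iff_datum_eq`,
`gaugeSection_of_forest` and the abstract `htransfer_isMin_of_thm1AtBase` are the twins' by name.  The displayed letters ((T1@q₀) central, (S)∕forest, (P8), `hcrit`, `honto`, `hnondeg`,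
the local class letter `hDreg'`) are UNCHANGED.

CONTENTS (0 `def`∕`instance`∕`sorry`).  §1 `continuousAt_datum_of_guardOn`; §2 ★★★ `hcritT_isMinimizer_of_thm1AtBase_central_of_guardOn`; §3 ★★★
`exists_localChart_at_baseField_of_thm1AtBase_central_of_guardOn` · ★★★ `exists_localChart_at_baseField_of_thm1AtBase_forest_central_of_guardOn`.
-/

noncomputable section

namespace Literature.MathematicalPhysics.QuantumFieldTheory.Balaban1983to89.B15Prop1LocalChartFromThm1AtBaseCentralTower

open Set Metric Filter
open scoped Topology
open Literature.MathematicalPhysics.QuantumFieldTheory.Balaban1983to89.Node00 (SU coeField coeField_apply SmallBelow ConstrSet constrCard constrEnum star_coe_mul_coe_SU)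
open B15AveragingHolomorphic (iterMh)
open B15ComplexifiedDatumFamily (conjVec)
open B15SU2ChartHolomorphic (expMulC logCoordC differentiableAt_logCoordC)
open B15Prop1StateChartSU2 (differentiable_expMulC_right)
open B15Prop1DatumCoordinates (expMulC_zero_left logCoordC_one)
open B15Prop1DatumCoordinatesTower (eventually_guardOn_constr polydiscOn_constr_of_guardOn)
open B15AveragingHolomorphicLocalAnalytic (analyticAt_iterMh_apply_of_polydiscOn)
open B15AveragingHolomorphicTowerRegion (preimage_blockIter_saturated self_mem_bondsIn_towerRegion iterMh_coeField_apply_eq_of_guardOn_towerRegion)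
open B15Prop1DatumCoordinates (deltaSU_le_one)
open B15Prop1ComplexWilsonAction (contDiffAt_actionSum actionSum_expMulC_cplxVec)
open B15Prop1CriticalChartFromIFT (cplxVec_zero)
open B15Prop1ClassOpenAtRecord (isInducing_coeField)
open B15Prop1LocalChartAtBaseFieldTower (exists_localChart_at_baseField_of_guardOn)
open B15Prop1SliceNondegeneracyFromRealCoercive (analyticAt_sliceAction)
open B15Prop1SliceNondegeneracyFromRealCoerciveTower (analyticAt_sliceDatum_of_guardOn)
open B15Prop1MinimiserFromBaseUniqueness (htransfer_isMin_of_thm1AtBase)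
open B15Prop1LocalChartFromThm1AtBase (agreeOn_iff_datum_eq)
open B15Prop1LocalChartFromThm1AtBaseCentral (datum_gaugeAct_of_central)
open B15Prop1GaugeSectionOfForest (gaugeSection_of_forest)
open Literature.Analysis.Calculus.ConstrainedCriticalPointLocallyUnique (exists_nhds_critical_unique)
open B14Eq16FaddeevPopov (wilsonAction4_gaugeAct')
open B16Thm1BaseAtRecord11 (continuous_wilsonAction4_SU)
open B12ContinuousTransportInvariance (continuous_gaugeAct_SU)
open B16Sect1Backgrounds (toMS iter_gaugeAct expMul expMul_zero)
open B15Prop1AnalyticExtClause (cplxVec)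
open B15Prop1ChartSU2 (su2Chart)
open ExpMeanLog (expMeanLogSU)
open BlockAveraging (blockAvg)
open T4CubeChartGnomonic (SU2)
open T4Continuum B15DeterminingSets GaugeField
open scoped Matrix.Norms.L2Operator

variable {P : Params}


/-! ## §1  The criticality transfer at `Crit := IsMinimizer`, local class letter, central Theorem-1 letter -/

/-! ## §1  The datum vector is continuous at every tower-guarded configuration -/

section Datum

variable (𝔹 : DetSet P) (k : ℕ)

/-- **THE DATUM VECTOR IS CONTINUOUS AT EVERY TOWER-GUARDED CONFIGURATION** (twin of `B15Prop1LocalChartFromThm1AtBase.continuousAt_datum`, which asks the global guard): under the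
per-tower (0.4) guards at the constrained bonds of `𝔹` at `U₁` (`k ≤ m + K`), the guards hold near `U₁` (`B15Prop1DatumCoordinatesTower.eventually_guardOn_constr`), where
`↑(Ū^j U)(c) = iterMh j ↑U c` (`iterMh_coeField_apply_eq_of_guardOn_towerRegion`), a continuous function of `U` (the iterate at `c` is analytic at `↑U₁` on the tower polydisc,
`B15AveragingHolomorphicLocalAnalytic.analyticAt_iterMh_apply_of_polydiscOn`). [cite: Balaban1985Variational, Prop. 9 p.309; Balaban1987RG1, (0.4) p.253] -/
theorem continuousAt_datum_of_guardOn (hk : k ≤ P.m + P.K) {U₁ : GaugeField P 0 SU2}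
    (hg : ∀ i : Fin (constrCard 𝔹 k), ∀ j', j' < (((constrEnum 𝔹 k).symm i).1 : ℕ) → ∀ c' : PBond P (j' + 1),
      c' ∈ B10Eq42TorusConstraint.bondsIn (j' + 1) (B14.Eq22Determines.blockIter (((constrEnum 𝔹 k).symm i).1 : ℕ) ⁻¹'
        ({((constrEnum 𝔹 k).symm i).2.1.src, ((constrEnum 𝔹 k).symm i).2.1.tgt} : Set (Site P ((constrEnum 𝔹 k).symm i).1))) →
        BlockAveraging.Small expMeanLogSU (Averaging.iter (fun j => blockAvg (P := P) (j := j) expMeanLogSU) j' U₁) c') :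
    ContinuousAt (fun (U : GaugeField P 0 SU2) (i : Fin (constrCard 𝔹 k)) =>
      ((avgFamily (fun j => blockAvg (P := P) (j := j) expMeanLogSU) U ((constrEnum 𝔹 k).symm i).1 ((constrEnum 𝔹 k).symm i).2.1 : SU2) :
        Matrix (Fin 2) (Fin 2) ℂ)) U₁ := by
  refine continuousAt_pi.2 fun i => ?_
  set s := (constrEnum 𝔹 k).symm i
  have hj : (s.1 : ℕ) ≤ P.m + P.K := (Nat.le_of_lt_succ s.1.2).trans hk
  have hcoe : Continuous (coeField : GaugeField P 0 SU2 → PBond P 0 → Matrix (Fin 2) (Fin 2) ℂ) := isInducing_coeField.continuous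
  have hev := (hcoe.continuousAt.eventually (eventually_guardOn_constr 𝔹 k hk hg)).mono fun U hU => hU U rfl
  have heq : (fun U : GaugeField P 0 SU2 => iterMh (s.1 : ℕ) (coeField U) s.2.1) =ᶠ[𝓝 U₁]
      fun U => ((avgFamily (fun j => blockAvg (P := P) (j := j) expMeanLogSU) U s.1 s.2.1 : SU2) : Matrix (Fin 2) (Fin 2) ℂ) :=
    hev.mono fun U hU => iterMh_coeField_apply_eq_of_guardOn_towerRegion hj _ (hU i)
  have hcont : ContinuousAt (fun U : GaugeField P 0 SU2 => iterMh (s.1 : ℕ) (coeField U) s.2.1) U₁ := by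
    have han : AnalyticAt ℂ (fun Q : PBond P 0 → Matrix (Fin 2) (Fin 2) ℂ => iterMh (s.1 : ℕ) Q s.2.1) (coeField U₁) :=
      analyticAt_iterMh_apply_of_polydiscOn _ hj (preimage_blockIter_saturated hj _)
        (fun j' hj' c' hc' i' => lt_of_lt_of_le (polydiscOn_constr_of_guardOn hj s.2.1 (hg i) (fun _ _ => rfl) j' hj' c' hc' i') deltaSU_le_one)
        _ (self_mem_bondsIn_towerRegion hj _)
    exact ContinuousAt.comp (f := coeField) han.continuousAt hcoe.continuousAt
  exact hcont.congr heq

end Datum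

section Transfer

/-- ★★★ **`hcritT` AT `Crit := IsMinimizer` FROM THEOREM 1 AT THE BASE DATUM.**  In the setting of `exists_localChart_at_baseField` (determining set `𝐁` of levels `≤ k ≤ m + K`, class
`reg`, base datum configuration `Q₀` and base state `U₀` guarded below `k`, `U₀` on the fibre of `Q₀`, conjugation-stable slice `S`, slice action `a` and slice datum coordinates
`Φ₀` characterised pointwise, `hcrit`∕`honto`∕`hnondeg` at `0`, `hclass`), assume the three class facts (`reg'` closed, `closure reg ⊆ reg'`, the `𝐁`-restricted averages continuous on `reg'` — the LOCAL form: NODE 00's class controls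
the configuration only on the domains `Ω_j`, so the global (0.4) guard of `hcritT_isMinimizer_of_thm1AtBase` is not available there) and the
three letters (T1@q₀) THEOREM 1 AT THE BASE DATUM, (S) RESIDUAL GAUGE SECTION near `U₀`, (P8) CHART-CRITICALITY OF MINIMISERS at chart points near `0`.  Then the `hcritT` binder of
`exists_localChart_at_baseField` holds with `Crit Q' U' := IsMinimizer av reg 𝐁 (Ū Q') U'`: a Lagrange-critical slice-chart point near `(0, ↑Q₀)` whose configuration lies on the fibre
of `Q'` IS a minimiser for the datum of `Q'`. [cite: Balaban1985Variational, Thm 1 p.279, (4) p.278, Prop 8 p.305, Sect. F p.300, Prop 9 p.309; Balaban1988Convergent, (2.10)–(2.12) p.256; Balaban1985Averaging, (11) p.19] -/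
theorem hcritT_isMinimizer_of_thm1AtBase_central_of_guardOn (𝔹 : DetSet P) (k : ℕ) (hk : k ≤ P.m + P.K) (h𝔹 : ∀ j, k < j → 𝔹 j = ∅) (reg reg' : Set (GaugeField P 0 SU2))
    {Q₀ U₀ : GaugeField P 0 SU2}
    (hgQ : ∀ i : Fin (constrCard 𝔹 k), ∀ j', j' < (((constrEnum 𝔹 k).symm i).1 : ℕ) → ∀ c' : PBond P (j' + 1),
      c' ∈ B10Eq42TorusConstraint.bondsIn (j' + 1) (B14.Eq22Determines.blockIter (((constrEnum 𝔹 k).symm i).1 : ℕ) ⁻¹'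
        ({((constrEnum 𝔹 k).symm i).2.1.src, ((constrEnum 𝔹 k).symm i).2.1.tgt} : Set (Site P ((constrEnum 𝔹 k).symm i).1))) →
        BlockAveraging.Small expMeanLogSU (Averaging.iter (fun j => blockAvg (P := P) (j := j) expMeanLogSU) j' Q₀) c')
    (hgU : ∀ i : Fin (constrCard 𝔹 k), ∀ j', j' < (((constrEnum 𝔹 k).symm i).1 : ℕ) → ∀ c' : PBond P (j' + 1),
      c' ∈ B10Eq42TorusConstraint.bondsIn (j' + 1) (B14.Eq22Determines.blockIter (((constrEnum 𝔹 k).symm i).1 : ℕ) ⁻¹'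
        ({((constrEnum 𝔹 k).symm i).2.1.src, ((constrEnum 𝔹 k).symm i).2.1.tgt} : Set (Site P ((constrEnum 𝔹 k).symm i).1))) →
        BlockAveraging.Small expMeanLogSU (Averaging.iter (fun j => blockAvg (P := P) (j := j) expMeanLogSU) j' U₀) c')
    (hU₀ : AgreeOn 𝔹 (avgFamily (fun j => blockAvg (P := P) (j := j) expMeanLogSU) U₀) (avgFamily (fun j => blockAvg (P := P) (j := j) expMeanLogSU) Q₀))
    (S : Submodule ℂ (VecField P 0 (EuclideanSpace ℂ (Fin 3))))
    (a : S → ℂ)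
    (ha : ∀ X : S, a X = ∑ p : Plaq P 0, (1 - (expMulC (X : VecField P 0 (EuclideanSpace ℂ (Fin 3))) (coeField U₀) ⟨p.src, p.μ⟩ *
      expMulC (X : VecField P 0 (EuclideanSpace ℂ (Fin 3))) (coeField U₀) ⟨p.src.shift p.μ, p.ν⟩ *
      Matrix.adjugate (expMulC (X : VecField P 0 (EuclideanSpace ℂ (Fin 3))) (coeField U₀) ⟨p.src.shift p.ν, p.μ⟩) *
      Matrix.adjugate (expMulC (X : VecField P 0 (EuclideanSpace ℂ (Fin 3))) (coeField U₀) ⟨p.src, p.ν⟩)).trace / 2))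
    (Φ₀ : S → Fin (constrCard 𝔹 k) → EuclideanSpace ℂ (Fin 3))
    (hΦ₀ : ∀ (X : S) i, Φ₀ X i = logCoordC (star ((avgFamily (fun j => blockAvg (P := P) (j := j) expMeanLogSU) Q₀ ((constrEnum 𝔹 k).symm i).1
      ((constrEnum 𝔹 k).symm i).2.1 : SU2) : Matrix (Fin 2) (Fin 2) ℂ) *
      iterMh ((constrEnum 𝔹 k).symm i).1 (expMulC (X : VecField P 0 (EuclideanSpace ℂ (Fin 3))) (coeField U₀)) ((constrEnum 𝔹 k).symm i).2.1))
    {ℓ₀ : (Fin (constrCard 𝔹 k) → EuclideanSpace ℂ (Fin 3)) →L[ℂ] ℂ}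
    (hcrit : fderiv ℂ a 0 = ℓ₀.comp (fderiv ℂ Φ₀ 0))
    (honto : Function.Surjective (fderiv ℂ Φ₀ 0))
    (hnondeg : ∀ s : S, fderiv ℂ Φ₀ 0 s = 0 →
      (∀ t : S, fderiv ℂ Φ₀ 0 t = 0 → fderiv ℂ (fderiv ℂ a) 0 s t - ℓ₀ (fderiv ℂ (fderiv ℂ Φ₀) 0 s t) = 0) → s = 0)
    (hclass : ∀ᶠ Q in 𝓝 (coeField U₀), ∀ U' : GaugeField P 0 SU2, coeField U' = Q → U' ∈ reg)
    -- the three CLASS facts: the closed-reading class `reg'`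
    (hreg' : IsClosed reg') (hcl : closure reg ⊆ reg')
    -- DISPLAYED (class letter, LOCAL form): the `𝐁`-restricted averages are continuous on the closed-reading class ([15] Prop. 9 on the blocks under the constrained bonds)
    (hDreg' : ContinuousOn (fun (U : GaugeField P 0 SU2) (i : Fin (constrCard 𝔹 k)) =>
      ((avgFamily (fun j => blockAvg (P := P) (j := j) expMeanLogSU) U ((constrEnum 𝔹 k).symm i).1 ((constrEnum 𝔹 k).symm i).2.1 : SU2) :
        Matrix (Fin 2) (Fin 2) ℂ)) reg')
    -- DISPLAYED (T1@q₀): Theorem 1 at the base datum — the DATUM-PRESERVING (central at the 𝐁-towers) orbit of `U₀` is the unique minimal orbit over `reg'`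
    (hT1 : ∀ U ∈ reg', AgreeOn 𝔹 (avgFamily (fun j => blockAvg (P := P) (j := j) expMeanLogSU) U) (avgFamily (fun j => blockAvg (P := P) (j := j) expMeanLogSU) Q₀) →
      wilsonAction4 U ≤ wilsonAction4 U₀ →
        ∃ u : GaugeTransf P 0 SU2, (∀ j, j ≤ k → ∀ b ∈ bondsOf (𝔹 j), toMS u j b.src = toMS u j b.tgt ∧ ∀ g : SU2, toMS u j b.src * g = g * toMS u j b.src) ∧ gaugeAct u U = U₀)
    -- DISPLAYED (S): a residual gauge section near `U₀` into the slice chart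
    (hSec : ∀ 𝒪 ∈ 𝓝 (0 : S), ∀ᶠ U in 𝓝 U₀, ∃ u : GaugeTransf P 0 SU2, (∀ j, j ≤ k → ∀ b ∈ bondsOf (𝔹 j), toMS u j b.src = 1 ∧ toMS u j b.tgt = 1) ∧
      ∃ x ∈ 𝒪, coeField (gaugeAct u U) = expMulC ((x : S) : VecField P 0 (EuclideanSpace ℂ (Fin 3))) (coeField U₀))
    -- DISPLAYED (P8): a minimiser over `reg` at a chart point near `0` is Lagrange-critical in the slice coordinates
    (hP8 : ∀ᶠ x in 𝓝 (0 : S), ∀ U' : GaugeField P 0 SU2, expMulC ((x : S) : VecField P 0 (EuclideanSpace ℂ (Fin 3))) (coeField U₀) = coeField U' →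
      IsMinimizer (fun j => blockAvg (P := P) (j := j) expMeanLogSU) reg 𝔹 (avgFamily (fun j => blockAvg (P := P) (j := j) expMeanLogSU) U') U' →
        ∃ μ : (Fin (constrCard 𝔹 k) → EuclideanSpace ℂ (Fin 3)) →L[ℂ] ℂ, fderiv ℂ a x = μ.comp (fderiv ℂ Φ₀ x)) :
    ∀ᶠ w in 𝓝 ((0 : S), coeField Q₀), ∀ (U' Q' : GaugeField P 0 SU2) (μ : (Fin (constrCard 𝔹 k) → EuclideanSpace ℂ (Fin 3)) →L[ℂ] ℂ),
      expMulC (w.1 : VecField P 0 (EuclideanSpace ℂ (Fin 3))) (coeField U₀) = coeField U' → coeField Q' = w.2 →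
        AgreeOn 𝔹 (avgFamily (fun j => blockAvg (P := P) (j := j) expMeanLogSU) U') (avgFamily (fun j => blockAvg (P := P) (j := j) expMeanLogSU) Q') →
        fderiv ℂ a w.1 = μ.comp (fderiv ℂ Φ₀ w.1) →
          IsMinimizer (fun j => blockAvg (P := P) (j := j) expMeanLogSU) reg 𝔹 (avgFamily (fun j => blockAvg (P := P) (j := j) expMeanLogSU) Q') U' := by
  haveI : CompactSpace (GaugeField P 0 SU2) := inferInstanceAs (CompactSpace (PBond P 0 → SU2))
  -- the objects of the abstract theorem
  set av : ∀ j, Averaging P j SU2 := fun j => blockAvg (P := P) (j := j) expMeanLogSU with hav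
  obtain ⟨D, hD⟩ : ∃ D : GaugeField P 0 SU2 → Fin (constrCard 𝔹 k) → Matrix (Fin 2) (Fin 2) ℂ,
      D = fun U i => ((avgFamily av U ((constrEnum 𝔹 k).symm i).1 ((constrEnum 𝔹 k).symm i).2.1 : SU2) : Matrix (Fin 2) (Fin 2) ℂ) := ⟨_, rfl⟩
  have hDagree : ∀ V W : GaugeField P 0 SU2, AgreeOn 𝔹 (avgFamily av V) (avgFamily av W) ↔ D V = D W := fun V W => by
    rw [hD]; exact agreeOn_iff_datum_eq 𝔹 k h𝔹 _ _
  obtain ⟨Res, hRes⟩ : ∃ Res : Set (GaugeField P 0 SU2 → GaugeField P 0 SU2),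
      Res = {g | ∃ u : GaugeTransf P 0 SU2, (∀ j, j ≤ k → ∀ b ∈ bondsOf (𝔹 j), toMS u j b.src = toMS u j b.tgt ∧ ∀ g : SU2, toMS u j b.src * g = g * toMS u j b.src) ∧ g = gaugeAct u} := ⟨_, rfl⟩
  obtain ⟨AC, hAC⟩ : ∃ AC : (PBond P 0 → Matrix (Fin 2) (Fin 2) ℂ) → ℂ, ∀ W, AC W = ∑ p : Plaq P 0, (1 - (W ⟨p.src, p.μ⟩ * W ⟨p.src.shift p.μ, p.ν⟩ *
      Matrix.adjugate (W ⟨p.src.shift p.ν, p.μ⟩) * Matrix.adjugate (W ⟨p.src, p.ν⟩)).trace / 2) := ⟨_, fun _ => rfl⟩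
  set χ : S → PBond P 0 → Matrix (Fin 2) (Fin 2) ℂ := fun x => expMulC (x : VecField P 0 (EuclideanSpace ℂ (Fin 3))) (coeField U₀) with hχdef
  -- topology of the objects
  have hcoe : Continuous (coeField : GaugeField P 0 SU2 → PBond P 0 → Matrix (Fin 2) (Fin 2) ℂ) := isInducing_coeField.continuous
  have hιinj : Function.Injective (coeField : GaugeField P 0 SU2 → PBond P 0 → Matrix (Fin 2) (Fin 2) ℂ) := fun U V h =>
    funext fun b => Subtype.ext (by simpa only [coeField_apply] using congrFun h b)
  have hA : Continuous (wilsonAction4 : GaugeField P 0 SU2 → ℝ) := continuous_wilsonAction4_SU (N := 2) (P := P) (j := 0)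
  have hDon : ContinuousOn D reg' := by rw [hD]; exact hDreg'
  have hDQ₀ : ContinuousAt D Q₀ := by rw [hD]; exact continuousAt_datum_of_guardOn 𝔹 k hk hgQ
  have hχc : ContinuousAt χ 0 := ((differentiable_expMulC_right (coeField U₀)).continuous.comp continuous_subtype_val).continuousAt
  have hχ₀ : χ 0 = coeField U₀ := by
    show expMulC ((0 : S) : VecField P 0 (EuclideanSpace ℂ (Fin 3))) (coeField U₀) = coeField U₀
    rw [Submodule.coe_zero, expMulC_zero_left]
  have hÂ : ContinuousAt (fun W => (AC W).re) (coeField U₀) :=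
    Complex.continuous_re.continuousAt.comp (contDiffAt_actionSum hAC (coeField U₀) (n := 0)).continuousAt
  have hÂι : ∀ U : GaugeField P 0 SU2, (AC (coeField U)).re = wilsonAction4 U := fun U => by
    have h := actionSum_expMulC_cplxVec hAC U (0 : VecField P 0 B15Prop1ChartCalculusSU2.E3)
    rw [cplxVec_zero, expMulC_zero_left, expMul_zero] at h
    rw [h, Complex.ofReal_re]
  have hU₀Q₀ : D U₀ = D Q₀ := (hDagree U₀ Q₀).1 hU₀
  have hres : ∀ g ∈ Res, Continuous g ∧ (∀ U, wilsonAction4 (g U) = wilsonAction4 U) ∧ (∀ U, D (g U) = D U) := by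
    rintro g hg
    rw [hRes] at hg
    obtain ⟨u, hu, rfl⟩ := hg
    refine ⟨continuous_gaugeAct_SU (N := 2) (P := P) (j := 0) u, fun U => wilsonAction4_gaugeAct' u U, fun U => ?_⟩
    rw [hD]
    funext i
    exact congrArg (fun g : SU2 => (g : Matrix (Fin 2) (Fin 2) ℂ)) (datum_gaugeAct_of_central 𝔹 k hk av u hu U i)
  -- (T1@q₀) in datum currency
  have hT1' : ∀ U ∈ reg', D U = D U₀ → wilsonAction4 U ≤ wilsonAction4 U₀ → ∃ g ∈ Res, g U = U₀ := by
    intro U hU hDU hAU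
    have hagree : AgreeOn 𝔹 (avgFamily av U) (avgFamily av Q₀) := (hDagree U Q₀).2 (hDU.trans hU₀Q₀)
    obtain ⟨u, hu, huU⟩ := hT1 U hU hagree hAU
    exact ⟨gaugeAct u, by rw [hRes]; exact ⟨u, hu, rfl⟩, huU⟩
  -- (S) in the abstract shape
  have hS' : ∀ 𝒪 ∈ 𝓝 (0 : S), ∀ᶠ U in 𝓝 U₀, ∃ g ∈ Res, ∃ x ∈ 𝒪, coeField (g U) = χ x := by
    intro 𝒪 h𝒪
    filter_upwards [hSec 𝒪 h𝒪] with U hU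
    obtain ⟨u, hu, x, hx, hux⟩ := hU
    exact ⟨gaugeAct u, by rw [hRes]; exact ⟨u, fun j hj b hb => ⟨by rw [(hu j hj b hb).1, (hu j hj b hb).2], fun g => by rw [(hu j hj b hb).1, one_mul, mul_one]⟩, rfl⟩, x, hx, hux⟩
  -- (P8) in the abstract shape
  have hP8' : ∀ᶠ x in 𝓝 (0 : S), ∀ U' : GaugeField P 0 SU2, χ x = coeField U' →
      (U' ∈ reg ∧ ∀ V ∈ reg, D V = D U' → wilsonAction4 U' ≤ wilsonAction4 V) →
        ∃ μ : (Fin (constrCard 𝔹 k) → EuclideanSpace ℂ (Fin 3)) →L[ℂ] ℂ, fderiv ℂ a x = μ.comp (fderiv ℂ Φ₀ x) := by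
    filter_upwards [hP8] with x hx U' hχU' hmin
    refine hx U' hχU' ⟨hmin.1, fun j b _ => rfl, fun V hV hVU => hmin.2 V hV ((hDagree V U').1 hVU)⟩
  -- (U): local uniqueness of chart-critical points, through the logarithmic datum coordinates
  have huniq' : ∃ 𝒪 ∈ 𝓝 (0 : S), ∃ 𝒬 ∈ 𝓝 (D U₀), ∀ (U' U'' : GaugeField P 0 SU2) (x x' : S), x ∈ 𝒪 → x' ∈ 𝒪 → χ x = coeField U' → χ x' = coeField U'' →
      D U' ∈ 𝒬 → D U'' = D U' → (∃ μ : (Fin (constrCard 𝔹 k) → EuclideanSpace ℂ (Fin 3)) →L[ℂ] ℂ, fderiv ℂ a x = μ.comp (fderiv ℂ Φ₀ x)) →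
      (∃ μ : (Fin (constrCard 𝔹 k) → EuclideanSpace ℂ (Fin 3)) →L[ℂ] ℂ, fderiv ℂ a x' = μ.comp (fderiv ℂ Φ₀ x')) → x = x' := by
    -- the generic uniqueness theorem for the analytic Lagrange system `(a, Φ₀)` at `0`
    have ha2 : ContDiffAt ℂ ((1 : WithTop ℕ∞) + 1) a 0 := (analyticAt_sliceAction S ha 0).contDiffAt
    have hΦ2 : ContDiffAt ℂ ((1 : WithTop ℕ∞) + 1) Φ₀ 0 := (analyticAt_sliceDatum_of_guardOn S 𝔹 k hk _ hgU hU₀ hΦ₀).contDiffAt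
    obtain ⟨O, hO, V, hV, huniq⟩ := exists_nhds_critical_unique (𝕜 := ℂ) (m := 1) one_ne_zero ha2 hΦ2 hcrit honto hnondeg
    -- the coordinates as a function of the datum vector: `κ̂ q = (logCoordC (W_i⋆ · q_i))_i`
    obtain ⟨κ, hκ⟩ : ∃ κ : (Fin (constrCard 𝔹 k) → Matrix (Fin 2) (Fin 2) ℂ) → Fin (constrCard 𝔹 k) → EuclideanSpace ℂ (Fin 3),
        ∀ q i, κ q i = logCoordC (star ((avgFamily av Q₀ ((constrEnum 𝔹 k).symm i).1 ((constrEnum 𝔹 k).symm i).2.1 : SU2) : Matrix (Fin 2) (Fin 2) ℂ) * q i) :=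
      ⟨_, fun _ _ => rfl⟩
    -- at a guarded chart point, `Φ₀ x = κ̂ (D U')`
    have hΦD : ∀ (x : S) (U' : GaugeField P 0 SU2), χ x = coeField U' → (∀ i : Fin (constrCard 𝔹 k), ∀ j', j' < (((constrEnum 𝔹 k).symm i).1 : ℕ) → ∀ c' : PBond P (j' + 1),
        c' ∈ B10Eq42TorusConstraint.bondsIn (j' + 1) (B14.Eq22Determines.blockIter (((constrEnum 𝔹 k).symm i).1 : ℕ) ⁻¹'
          ({((constrEnum 𝔹 k).symm i).2.1.src, ((constrEnum 𝔹 k).symm i).2.1.tgt} : Set (Site P ((constrEnum 𝔹 k).symm i).1))) →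
          BlockAveraging.Small expMeanLogSU (Averaging.iter (fun j => blockAvg (P := P) (j := j) expMeanLogSU) j' U') c') → Φ₀ x = κ (D U') := by
      intro x U' hχU' hsb'
      have hx : expMulC (x : VecField P 0 (EuclideanSpace ℂ (Fin 3))) (coeField U₀) = coeField U' := hχU'
      funext i
      have hj : (((constrEnum 𝔹 k).symm i).1 : ℕ) ≤ k := Nat.le_of_lt_succ ((constrEnum 𝔹 k).symm i).1.2
      have hi : iterMh (((constrEnum 𝔹 k).symm i).1 : ℕ) (coeField U') ((constrEnum 𝔹 k).symm i).2.1 =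
          ((avgFamily av U' ((constrEnum 𝔹 k).symm i).1 ((constrEnum 𝔹 k).symm i).2.1 : SU2) : Matrix (Fin 2) (Fin 2) ℂ) := by
        rw [iterMh_coeField_apply_eq_of_guardOn_towerRegion (hj.trans hk) _ (hsb' i)]
        rfl
      rw [hΦ₀, hκ, hD, hx, hi]
    -- `κ̂` is continuous at the base datum vector and `κ̂ (D U₀) = Φ₀ 0`
    have hκD₀ : κ (D U₀) = Φ₀ 0 := (hΦD 0 U₀ hχ₀ hgU).symm
    have hκc : ContinuousAt κ (D U₀) := by
      refine continuousAt_pi.2 fun i => ?_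
      have hfun : (fun q => κ q i) = fun q : Fin (constrCard 𝔹 k) → Matrix (Fin 2) (Fin 2) ℂ =>
          logCoordC (star ((avgFamily av Q₀ ((constrEnum 𝔹 k).symm i).1 ((constrEnum 𝔹 k).symm i).2.1 : SU2) : Matrix (Fin 2) (Fin 2) ℂ) * q i) :=
        funext fun q => hκ q i
      rw [hfun]
      have hone : star ((avgFamily av Q₀ ((constrEnum 𝔹 k).symm i).1 ((constrEnum 𝔹 k).symm i).2.1 : SU2) : Matrix (Fin 2) (Fin 2) ℂ) * D U₀ i = 1 := by
        rw [hD]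
        show star _ * ((avgFamily av U₀ _ _ : SU2) : Matrix (Fin 2) (Fin 2) ℂ) = 1
        rw [hU₀ _ _ ((constrEnum 𝔹 k).symm i).2.2, star_coe_mul_coe_SU]
      have hlog : ContinuousAt logCoordC (star ((avgFamily av Q₀ ((constrEnum 𝔹 k).symm i).1 ((constrEnum 𝔹 k).symm i).2.1 : SU2) : Matrix (Fin 2) (Fin 2) ℂ) * D U₀ i) := by
        rw [hone]
        exact (differentiableAt_logCoordC (by rw [sub_self, norm_zero]; exact one_pos)).continuousAt
      have hq : ContinuousAt (fun q : Fin (constrCard 𝔹 k) → Matrix (Fin 2) (Fin 2) ℂ => q i) (D U₀) := (continuous_apply i).continuousAt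
      have hmul : ContinuousAt (fun q : Fin (constrCard 𝔹 k) → Matrix (Fin 2) (Fin 2) ℂ =>
          star ((avgFamily av Q₀ ((constrEnum 𝔹 k).symm i).1 ((constrEnum 𝔹 k).symm i).2.1 : SU2) : Matrix (Fin 2) (Fin 2) ℂ) * q i) (D U₀) :=
        continuousAt_const.mul hq
      exact ContinuousAt.comp_of_eq (g := logCoordC)
        (f := fun q : Fin (constrCard 𝔹 k) → Matrix (Fin 2) (Fin 2) ℂ =>
          star ((avgFamily av Q₀ ((constrEnum 𝔹 k).symm i).1 ((constrEnum 𝔹 k).symm i).2.1 : SU2) : Matrix (Fin 2) (Fin 2) ℂ) * q i) hlog hmul rfl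
    have h𝒬 : κ ⁻¹' O ∈ 𝓝 (D U₀) := hκc.preimage_mem_nhds (by rw [hκD₀]; exact hO)
    -- the guard at chart points near `0`
    have hguard : ∀ᶠ x in 𝓝 (0 : S), ∀ U' : GaugeField P 0 SU2, χ x = coeField U' → ∀ i : Fin (constrCard 𝔹 k), ∀ j', j' < (((constrEnum 𝔹 k).symm i).1 : ℕ) → ∀ c' : PBond P (j' + 1),
        c' ∈ B10Eq42TorusConstraint.bondsIn (j' + 1) (B14.Eq22Determines.blockIter (((constrEnum 𝔹 k).symm i).1 : ℕ) ⁻¹'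
          ({((constrEnum 𝔹 k).symm i).2.1.src, ((constrEnum 𝔹 k).symm i).2.1.tgt} : Set (Site P ((constrEnum 𝔹 k).symm i).1))) →
          BlockAveraging.Small expMeanLogSU (Averaging.iter (fun j => blockAvg (P := P) (j := j) expMeanLogSU) j' U') c' := by
      have h := eventually_guardOn_constr 𝔹 k hk hgU
      rw [← hχ₀] at h
      filter_upwards [hχc.eventually h] with x hx U' hU'
      exact hx U' hU'.symm
    refine ⟨V ∩ {x | ∀ U' : GaugeField P 0 SU2, χ x = coeField U' → ∀ i : Fin (constrCard 𝔹 k), ∀ j', j' < (((constrEnum 𝔹 k).symm i).1 : ℕ) → ∀ c' : PBond P (j' + 1),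
        c' ∈ B10Eq42TorusConstraint.bondsIn (j' + 1) (B14.Eq22Determines.blockIter (((constrEnum 𝔹 k).symm i).1 : ℕ) ⁻¹'
          ({((constrEnum 𝔹 k).symm i).2.1.src, ((constrEnum 𝔹 k).symm i).2.1.tgt} : Set (Site P ((constrEnum 𝔹 k).symm i).1))) →
          BlockAveraging.Small expMeanLogSU (Averaging.iter (fun j => blockAvg (P := P) (j := j) expMeanLogSU) j' U') c'}, inter_mem hV hguard, κ ⁻¹' O, h𝒬,
      fun U' U'' x x' hx hx' hχU' hχU'' hDU' hDU'' hc hc' => ?_⟩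
    obtain ⟨μ, hμ⟩ := hc
    obtain ⟨μ', hμ'⟩ := hc'
    have hΦx : Φ₀ x = κ (D U') := hΦD x U' hχU' (hx.2 U' hχU')
    have hΦx' : Φ₀ x' = κ (D U') := by rw [← hDU'']; exact hΦD x' U'' hχU'' (hx'.2 U'' hχU'')
    exact huniq (κ (D U')) hDU' x hx.1 x' hx'.1 μ μ' hμ hΦx hμ' hΦx'
  -- the abstract theorem
  have key := htransfer_isMin_of_thm1AtBase (X := GaugeField P 0 SU2) (reg := reg) (reg' := reg') (Res := Res) (U₀ := U₀) (Q₀ := Q₀)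
    (ι := coeField) (χ := χ) (x₀ := 0) (Â := fun W => (AC W).re)
    (LCrit := fun x : S => ∃ μ : (Fin (constrCard 𝔹 k) → EuclideanSpace ℂ (Fin 3)) →L[ℂ] ℂ, fderiv ℂ a x = μ.comp (fderiv ℂ Φ₀ x))
    (A := wilsonAction4) (D := D) hA hreg' hDon hDQ₀ hcl hres hT1' isInducing_coeField hιinj hχc hχ₀ hÂ hÂι hU₀Q₀ hclass hS' hP8' huniq'
  filter_upwards [key] with w hw U' Q' μ hχU' hQ' hagree hμ
  obtain ⟨hreg, hDU', hmin⟩ := hw U' Q' hχU' hQ' ((hDagree U' Q').1 hagree) ⟨μ, hμ⟩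
  exact ⟨hreg, hagree, fun V hV hVQ => hmin V hV ((hDagree V Q').1 hVQ)⟩

end Transfer

/-! ## §2  The chart theorems, local class letter -/

section Chart

/-- ★★★ **THE LOCAL HOLOMORPHIC MINIMISER CHART AT ONE BASE FIELD FROM THEOREM 1 AT THE BASE DATUM.**  `B15Prop1LocalChartAtBaseField.exists_localChart_at_baseField` with its two
letters `hcritT` ([15] Sect. F at an abstract `Crit`) and `hT1u` ([15] Thm 1's uniqueness clause for ALL nearby data) REPLACED by: the three class facts (`reg'` closed, `closure reg ⊆
reg'`, `𝐁`-averages continuous on `reg'`), (T1@q₀) THEOREM 1 AT THE BASE DATUM (the residual orbit of `U₀` is the unique minimal orbit over `reg'` on the base fibre), (S) a RESIDUAL GAUGE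
SECTION near `U₀` into the slice chart, (P8) [15] Prop. 8 at chart points; plus `k ≤ m + K` (gauge covariance of the averages).  Same conclusion: an open `O ∋ ↑Q₀` and a bounded
holomorphic matrix family `Γ` on `O` whose value at every `SU(2)` datum `Q' ∈ O` is a MINIMISER for the datum of `Q'`.  Proof: `Crit := IsMinimizer`, `hT1u := id`,
`hcritT := hcritT_isMinimizer_of_thm1AtBase`. [cite: Balaban1985Variational, Thm 1 p.279, (4) p.278, Sect. C (47)–(48) p.285, Sect. F p.300, Prop 8 p.305, Sect. G pp.305–307, Prop 9 (190) p.309; Balaban1988Convergent, (2.10)–(2.12) p.256; Balaban1989LargeFieldI, Prop. 1 p.194 (last clause); LuenbergerYe2008, §10.7 pp.306–307] -/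
theorem exists_localChart_at_baseField_of_thm1AtBase_central_of_guardOn (𝔹 : DetSet P) (k : ℕ) (hk : k ≤ P.m + P.K) (h𝔹 : ∀ j, k < j → 𝔹 j = ∅) (reg : Set (GaugeField P 0 SU2))
    {Q₀ U₀ : GaugeField P 0 SU2}
    (hgQ : ∀ i : Fin (constrCard 𝔹 k), ∀ j', j' < (((constrEnum 𝔹 k).symm i).1 : ℕ) → ∀ c' : PBond P (j' + 1),
      c' ∈ B10Eq42TorusConstraint.bondsIn (j' + 1) (B14.Eq22Determines.blockIter (((constrEnum 𝔹 k).symm i).1 : ℕ) ⁻¹'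
        ({((constrEnum 𝔹 k).symm i).2.1.src, ((constrEnum 𝔹 k).symm i).2.1.tgt} : Set (Site P ((constrEnum 𝔹 k).symm i).1))) →
        BlockAveraging.Small expMeanLogSU (Averaging.iter (fun j => blockAvg (P := P) (j := j) expMeanLogSU) j' Q₀) c')
    (hgU : ∀ i : Fin (constrCard 𝔹 k), ∀ j', j' < (((constrEnum 𝔹 k).symm i).1 : ℕ) → ∀ c' : PBond P (j' + 1),
      c' ∈ B10Eq42TorusConstraint.bondsIn (j' + 1) (B14.Eq22Determines.blockIter (((constrEnum 𝔹 k).symm i).1 : ℕ) ⁻¹'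
        ({((constrEnum 𝔹 k).symm i).2.1.src, ((constrEnum 𝔹 k).symm i).2.1.tgt} : Set (Site P ((constrEnum 𝔹 k).symm i).1))) →
        BlockAveraging.Small expMeanLogSU (Averaging.iter (fun j => blockAvg (P := P) (j := j) expMeanLogSU) j' U₀) c')
    (hU₀ : AgreeOn 𝔹 (avgFamily (fun j => blockAvg (P := P) (j := j) expMeanLogSU) U₀) (avgFamily (fun j => blockAvg (P := P) (j := j) expMeanLogSU) Q₀))
    -- the gauge slice
    (S : Submodule ℂ (VecField P 0 (EuclideanSpace ℂ (Fin 3)))) (hS : ∀ X ∈ S, conjVec X ∈ S)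
    -- the action and the constraint coordinates on the slice, characterised pointwise
    (a : S → ℂ)
    (ha : ∀ X : S, a X = ∑ p : Plaq P 0, (1 - (expMulC (X : VecField P 0 (EuclideanSpace ℂ (Fin 3))) (coeField U₀) ⟨p.src, p.μ⟩ *
      expMulC (X : VecField P 0 (EuclideanSpace ℂ (Fin 3))) (coeField U₀) ⟨p.src.shift p.μ, p.ν⟩ *
      Matrix.adjugate (expMulC (X : VecField P 0 (EuclideanSpace ℂ (Fin 3))) (coeField U₀) ⟨p.src.shift p.ν, p.μ⟩) *
      Matrix.adjugate (expMulC (X : VecField P 0 (EuclideanSpace ℂ (Fin 3))) (coeField U₀) ⟨p.src, p.ν⟩)).trace / 2))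
    (Φ₀ : S → Fin (constrCard 𝔹 k) → EuclideanSpace ℂ (Fin 3))
    (hΦ₀ : ∀ (X : S) i, Φ₀ X i = logCoordC (star ((avgFamily (fun j => blockAvg (P := P) (j := j) expMeanLogSU) Q₀ ((constrEnum 𝔹 k).symm i).1
      ((constrEnum 𝔹 k).symm i).2.1 : SU2) : Matrix (Fin 2) (Fin 2) ℂ) *
      iterMh ((constrEnum 𝔹 k).symm i).1 (expMulC (X : VecField P 0 (EuclideanSpace ℂ (Fin 3))) (coeField U₀)) ((constrEnum 𝔹 k).symm i).2.1))
    -- DISPLAYED: Lagrange criticality of the base state, «onto», (β) nondegeneracy — in these coordinates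
    {ℓ₀ : (Fin (constrCard 𝔹 k) → EuclideanSpace ℂ (Fin 3)) →L[ℂ] ℂ}
    (hcrit : fderiv ℂ a 0 = ℓ₀.comp (fderiv ℂ Φ₀ 0))
    (honto : Function.Surjective (fderiv ℂ Φ₀ 0))
    (hnondeg : ∀ s : S, fderiv ℂ Φ₀ 0 s = 0 →
      (∀ t : S, fderiv ℂ Φ₀ 0 t = 0 → fderiv ℂ (fderiv ℂ a) 0 s t - ℓ₀ (fderiv ℂ (fderiv ℂ Φ₀) 0 s t) = 0) → s = 0)
    -- DISPLAYED: the class is open at `U₀`; criticality transfer; [15] Thm 1's uniqueness clause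
    (hclass : ∀ᶠ Q in 𝓝 (coeField U₀), ∀ U' : GaugeField P 0 SU2, coeField U' = Q → U' ∈ reg)
    -- the three CLASS facts: the closed-reading class `reg'`
    (reg' : Set (GaugeField P 0 SU2)) (hreg' : IsClosed reg') (hcl : closure reg ⊆ reg')
    (hDreg' : ContinuousOn (fun (U : GaugeField P 0 SU2) (i : Fin (constrCard 𝔹 k)) =>
      ((avgFamily (fun j => blockAvg (P := P) (j := j) expMeanLogSU) U ((constrEnum 𝔹 k).symm i).1 ((constrEnum 𝔹 k).symm i).2.1 : SU2) :
        Matrix (Fin 2) (Fin 2) ℂ)) reg')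
    -- DISPLAYED (T1@q₀): Theorem 1 at the base datum — the DATUM-PRESERVING (central at the 𝐁-towers) orbit of `U₀` is the unique minimal orbit over `reg'`
    (hT1 : ∀ U ∈ reg', AgreeOn 𝔹 (avgFamily (fun j => blockAvg (P := P) (j := j) expMeanLogSU) U) (avgFamily (fun j => blockAvg (P := P) (j := j) expMeanLogSU) Q₀) →
      wilsonAction4 U ≤ wilsonAction4 U₀ →
        ∃ u : GaugeTransf P 0 SU2, (∀ j, j ≤ k → ∀ b ∈ bondsOf (𝔹 j), toMS u j b.src = toMS u j b.tgt ∧ ∀ g : SU2, toMS u j b.src * g = g * toMS u j b.src) ∧ gaugeAct u U = U₀)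
    -- DISPLAYED (S): a residual gauge section near `U₀` into the slice chart
    (hSec : ∀ 𝒪 ∈ 𝓝 (0 : S), ∀ᶠ U in 𝓝 U₀, ∃ u : GaugeTransf P 0 SU2, (∀ j, j ≤ k → ∀ b ∈ bondsOf (𝔹 j), toMS u j b.src = 1 ∧ toMS u j b.tgt = 1) ∧
      ∃ x ∈ 𝒪, coeField (gaugeAct u U) = expMulC ((x : S) : VecField P 0 (EuclideanSpace ℂ (Fin 3))) (coeField U₀))
    -- DISPLAYED (P8): a minimiser over `reg` at a chart point near `0` is Lagrange-critical in the slice coordinates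
    (hP8 : ∀ᶠ x in 𝓝 (0 : S), ∀ U' : GaugeField P 0 SU2, expMulC ((x : S) : VecField P 0 (EuclideanSpace ℂ (Fin 3))) (coeField U₀) = coeField U' →
      IsMinimizer (fun j => blockAvg (P := P) (j := j) expMeanLogSU) reg 𝔹 (avgFamily (fun j => blockAvg (P := P) (j := j) expMeanLogSU) U') U' →
        ∃ μ : (Fin (constrCard 𝔹 k) → EuclideanSpace ℂ (Fin 3)) →L[ℂ] ℂ, fderiv ℂ a x = μ.comp (fderiv ℂ Φ₀ x))
    {𝓐₀ : ℝ} (h𝓐₀ : 1 < 𝓐₀) :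
    ∃ O : Set (PBond P 0 → Matrix (Fin 2) (Fin 2) ℂ), IsOpen O ∧ coeField Q₀ ∈ O ∧
      ∃ Γ : (PBond P 0 → Matrix (Fin 2) (Fin 2) ℂ) → PBond P 0 → Matrix (Fin 2) (Fin 2) ℂ,
        (∀ b i j, DifferentiableOn ℂ (fun Q => Γ Q b i j) O) ∧
        (∀ Q ∈ O, ∀ b i j, ‖Γ Q b i j‖ ≤ 𝓐₀) ∧
        ∀ Q' : GaugeField P 0 SU2, coeField Q' ∈ O →
          ∃ U' : GaugeField P 0 SU2, (∀ b, Γ (coeField Q') b = ((U' b : SU2) : Matrix (Fin 2) (Fin 2) ℂ)) ∧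
            IsMinimizer (fun j => blockAvg (P := P) (j := j) expMeanLogSU) reg 𝔹 (avgFamily (fun j => blockAvg (P := P) (j := j) expMeanLogSU) Q') U' :=
  exists_localChart_at_baseField_of_guardOn 𝔹 k h𝔹 reg hk hgQ hgU hU₀ S hS a ha Φ₀ hΦ₀ hcrit honto hnondeg
    (fun Q' U' => IsMinimizer (fun j => blockAvg (P := P) (j := j) expMeanLogSU) reg 𝔹 (avgFamily (fun j => blockAvg (P := P) (j := j) expMeanLogSU) Q') U')
    hclass
    (hcritT_isMinimizer_of_thm1AtBase_central_of_guardOn 𝔹 k hk h𝔹 reg reg' hgQ hgU hU₀ S a ha Φ₀ hΦ₀ hcrit honto hnondeg hclass hreg' hcl hDreg' hT1 hSec hP8)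
    (Filter.Eventually.of_forall fun _ _ _ _ _ _ h => h) h𝓐₀

/-- ★★★ **THE LOCAL HOLOMORPHIC MINIMISER CHART AT ONE BASE FIELD, ON THE AXIAL SLICE OF A ROOTED FOREST, FROM THEOREM 1 AT THE BASE DATUM.**
`B15Prop1LocalChartFromThm1AtBase.exists_localChart_at_baseField_of_thm1AtBase` with the slice `S` = the axial slice (F3) of a rooted forest `path` with (F1), (F2) — so that the
conjugation-stability of `S` and the residual gauge section (S) are THEOREMS (`gaugeSection_of_forest`) — leaving displayed, per base field: `hcrit`, `honto`, (β) `hnondeg`, `hclass`,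
the class facts, (T1@q₀) Theorem 1 at the base datum, (P8) Prop. 8 at chart points, and the forest datum (print's comb `Ax_k(𝔅_k, U₀)`, [6] (1.19)). [cite: Balaban1985Variational, Thm 1 p.279, (4) p.278, (16)–(18) p.280, Sect. C (47)–(48) p.285, Sect. F p.300, Prop 8 p.305, Sect. G pp.305–307, Prop 9 (190) p.309; Balaban1985RegularSpaces, (1.19) p.79; Balaban1988Convergent, (2.10)–(2.12) p.256; Balaban1989LargeFieldI, Prop. 1 p.194 (last clause)] -/
theorem exists_localChart_at_baseField_of_thm1AtBase_forest_central_of_guardOn (𝔹 : DetSet P) (k : ℕ) (hk : k ≤ P.m + P.K) (h𝔹 : ∀ j, k < j → 𝔹 j = ∅) (reg : Set (GaugeField P 0 SU2))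
    {Q₀ U₀ : GaugeField P 0 SU2}
    (hgQ : ∀ i : Fin (constrCard 𝔹 k), ∀ j', j' < (((constrEnum 𝔹 k).symm i).1 : ℕ) → ∀ c' : PBond P (j' + 1),
      c' ∈ B10Eq42TorusConstraint.bondsIn (j' + 1) (B14.Eq22Determines.blockIter (((constrEnum 𝔹 k).symm i).1 : ℕ) ⁻¹'
        ({((constrEnum 𝔹 k).symm i).2.1.src, ((constrEnum 𝔹 k).symm i).2.1.tgt} : Set (Site P ((constrEnum 𝔹 k).symm i).1))) →
        BlockAveraging.Small expMeanLogSU (Averaging.iter (fun j => blockAvg (P := P) (j := j) expMeanLogSU) j' Q₀) c')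
    (hgU : ∀ i : Fin (constrCard 𝔹 k), ∀ j', j' < (((constrEnum 𝔹 k).symm i).1 : ℕ) → ∀ c' : PBond P (j' + 1),
      c' ∈ B10Eq42TorusConstraint.bondsIn (j' + 1) (B14.Eq22Determines.blockIter (((constrEnum 𝔹 k).symm i).1 : ℕ) ⁻¹'
        ({((constrEnum 𝔹 k).symm i).2.1.src, ((constrEnum 𝔹 k).symm i).2.1.tgt} : Set (Site P ((constrEnum 𝔹 k).symm i).1))) →
        BlockAveraging.Small expMeanLogSU (Averaging.iter (fun j => blockAvg (P := P) (j := j) expMeanLogSU) j' U₀) c')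
    (hU₀ : AgreeOn 𝔹 (avgFamily (fun j => blockAvg (P := P) (j := j) expMeanLogSU) U₀) (avgFamily (fun j => blockAvg (P := P) (j := j) expMeanLogSU) Q₀))
    -- the gauge slice = the axial slice of a rooted forest (F3), with (F1) prefix∕orientation and (F2) roots at the block towers of the constrained bonds
    (S : Submodule ℂ (VecField P 0 (EuclideanSpace ℂ (Fin 3))))
    (path : Site P 0 → List (LStep P 0))
    (hF1 : ∀ x, ∀ s ∈ path x, ∃ x' x'' : Site P 0, path x'' = path x' ++ [s] ∧
      (s.fwd = true → s.bond.src = x' ∧ s.bond.tgt = x'') ∧ (s.fwd = false → s.bond.src = x'' ∧ s.bond.tgt = x'))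
    (hF2 : ∀ j, j ≤ k → ∀ c ∈ bondsOf (𝔹 j), path (embIter j c.src) = [] ∧ path (embIter j c.tgt) = [])
    (hF3 : ∀ X : VecField P 0 (EuclideanSpace ℂ (Fin 3)), X ∈ S ↔ ∀ x, ∀ s ∈ path x, X s.bond = 0)
    -- the action and the constraint coordinates on the slice, characterised pointwise
    (a : S → ℂ)
    (ha : ∀ X : S, a X = ∑ p : Plaq P 0, (1 - (expMulC (X : VecField P 0 (EuclideanSpace ℂ (Fin 3))) (coeField U₀) ⟨p.src, p.μ⟩ *
      expMulC (X : VecField P 0 (EuclideanSpace ℂ (Fin 3))) (coeField U₀) ⟨p.src.shift p.μ, p.ν⟩ *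
      Matrix.adjugate (expMulC (X : VecField P 0 (EuclideanSpace ℂ (Fin 3))) (coeField U₀) ⟨p.src.shift p.ν, p.μ⟩) *
      Matrix.adjugate (expMulC (X : VecField P 0 (EuclideanSpace ℂ (Fin 3))) (coeField U₀) ⟨p.src, p.ν⟩)).trace / 2))
    (Φ₀ : S → Fin (constrCard 𝔹 k) → EuclideanSpace ℂ (Fin 3))
    (hΦ₀ : ∀ (X : S) i, Φ₀ X i = logCoordC (star ((avgFamily (fun j => blockAvg (P := P) (j := j) expMeanLogSU) Q₀ ((constrEnum 𝔹 k).symm i).1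
      ((constrEnum 𝔹 k).symm i).2.1 : SU2) : Matrix (Fin 2) (Fin 2) ℂ) *
      iterMh ((constrEnum 𝔹 k).symm i).1 (expMulC (X : VecField P 0 (EuclideanSpace ℂ (Fin 3))) (coeField U₀)) ((constrEnum 𝔹 k).symm i).2.1))
    -- DISPLAYED: Lagrange criticality of the base state, «onto», (β) nondegeneracy — in these coordinates
    {ℓ₀ : (Fin (constrCard 𝔹 k) → EuclideanSpace ℂ (Fin 3)) →L[ℂ] ℂ}
    (hcrit : fderiv ℂ a 0 = ℓ₀.comp (fderiv ℂ Φ₀ 0))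
    (honto : Function.Surjective (fderiv ℂ Φ₀ 0))
    (hnondeg : ∀ s : S, fderiv ℂ Φ₀ 0 s = 0 →
      (∀ t : S, fderiv ℂ Φ₀ 0 t = 0 → fderiv ℂ (fderiv ℂ a) 0 s t - ℓ₀ (fderiv ℂ (fderiv ℂ Φ₀) 0 s t) = 0) → s = 0)
    -- DISPLAYED: the class is open at `U₀`; criticality transfer; [15] Thm 1's uniqueness clause
    (hclass : ∀ᶠ Q in 𝓝 (coeField U₀), ∀ U' : GaugeField P 0 SU2, coeField U' = Q → U' ∈ reg)
    -- the three CLASS facts: the closed-reading class `reg'`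
    (reg' : Set (GaugeField P 0 SU2)) (hreg' : IsClosed reg') (hcl : closure reg ⊆ reg')
    (hDreg' : ContinuousOn (fun (U : GaugeField P 0 SU2) (i : Fin (constrCard 𝔹 k)) =>
      ((avgFamily (fun j => blockAvg (P := P) (j := j) expMeanLogSU) U ((constrEnum 𝔹 k).symm i).1 ((constrEnum 𝔹 k).symm i).2.1 : SU2) :
        Matrix (Fin 2) (Fin 2) ℂ)) reg')
    -- DISPLAYED (T1@q₀): Theorem 1 at the base datum — the DATUM-PRESERVING (central at the 𝐁-towers) orbit of `U₀` is the unique minimal orbit over `reg'`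
    (hT1 : ∀ U ∈ reg', AgreeOn 𝔹 (avgFamily (fun j => blockAvg (P := P) (j := j) expMeanLogSU) U) (avgFamily (fun j => blockAvg (P := P) (j := j) expMeanLogSU) Q₀) →
      wilsonAction4 U ≤ wilsonAction4 U₀ →
        ∃ u : GaugeTransf P 0 SU2, (∀ j, j ≤ k → ∀ b ∈ bondsOf (𝔹 j), toMS u j b.src = toMS u j b.tgt ∧ ∀ g : SU2, toMS u j b.src * g = g * toMS u j b.src) ∧ gaugeAct u U = U₀)
    -- DISPLAYED (P8): a minimiser over `reg` at a chart point near `0` is Lagrange-critical in the slice coordinates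
    (hP8 : ∀ᶠ x in 𝓝 (0 : S), ∀ U' : GaugeField P 0 SU2, expMulC ((x : S) : VecField P 0 (EuclideanSpace ℂ (Fin 3))) (coeField U₀) = coeField U' →
      IsMinimizer (fun j => blockAvg (P := P) (j := j) expMeanLogSU) reg 𝔹 (avgFamily (fun j => blockAvg (P := P) (j := j) expMeanLogSU) U') U' →
        ∃ μ : (Fin (constrCard 𝔹 k) → EuclideanSpace ℂ (Fin 3)) →L[ℂ] ℂ, fderiv ℂ a x = μ.comp (fderiv ℂ Φ₀ x))
    {𝓐₀ : ℝ} (h𝓐₀ : 1 < 𝓐₀) :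
    ∃ O : Set (PBond P 0 → Matrix (Fin 2) (Fin 2) ℂ), IsOpen O ∧ coeField Q₀ ∈ O ∧
      ∃ Γ : (PBond P 0 → Matrix (Fin 2) (Fin 2) ℂ) → PBond P 0 → Matrix (Fin 2) (Fin 2) ℂ,
        (∀ b i j, DifferentiableOn ℂ (fun Q => Γ Q b i j) O) ∧
        (∀ Q ∈ O, ∀ b i j, ‖Γ Q b i j‖ ≤ 𝓐₀) ∧
        ∀ Q' : GaugeField P 0 SU2, coeField Q' ∈ O →
          ∃ U' : GaugeField P 0 SU2, (∀ b, Γ (coeField Q') b = ((U' b : SU2) : Matrix (Fin 2) (Fin 2) ℂ)) ∧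
            IsMinimizer (fun j => blockAvg (P := P) (j := j) expMeanLogSU) reg 𝔹 (avgFamily (fun j => blockAvg (P := P) (j := j) expMeanLogSU) Q') U' :=
  exists_localChart_at_baseField_of_thm1AtBase_central_of_guardOn 𝔹 k hk h𝔹 reg hgQ hgU hU₀ S
    (fun X hX => (hF3 _).2 fun x s hs => by
      have h0 : X s.bond = 0 := (hF3 X).1 hX x s hs
      ext a
      simp [conjVec, h0])
    a ha Φ₀ hΦ₀ hcrit honto hnondeg hclass reg' hreg' hcl hDreg' hT1 (gaugeSection_of_forest 𝔹 k U₀ S path hF1 hF2 hF3) hP8 h𝓐₀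

end Chart

end Literature.MathematicalPhysics.QuantumFieldTheory.Balaban1983to89.B15Prop1LocalChartFromThm1AtBaseCentralTower

end
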